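import Summits.CriticalPhenomena.PercolationContinuityZ3.Theorems.PercNearOneGluingNoHeavyPcintBSMRCoef4
import HarnessLib

/-!
# PCINT lane, PHASE 12 (plane method, long horizons): coefficient tables (adjacent check, real forms) for `k = 4` time axes, exact below `M = 150`, flat to `2000`

Cell `prim-pcint`, seat `prim-pcint-4` (gen 0); memo `run/shared/lean/prim/pcint/T-FIBRE-ROUTE.md` §PHASE 12.
`U_i ≥ u 4 i · DU`, `C_i ≥ cadj 4 i · DU` (`DU = 10^15`) for `i < 2000`: the first `150` entries are the rounded-up exact
values (checked against `OSM.vrow 4 150` / `OSM.vrow 4 151` in the kernel), the remaining `1850` entries equal `U_149`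
(sound by `BSMR.u_real_flat` / `BSMR.cadj_real_flat`: `u` is non-increasing and `0 ≤ cadj ≤ u`).  Usable by every plane-method
instance with `k = 4` and horizon `N ≤ 2000` (site or bond, any reach).  Generated by the seat's `work/emitQ.py coef_files`.
-/

namespace Summit.CriticalPhenomena.PercolationContinuityZ3.Theorems.Pcint.BSMR.Coef4

open Summit.CriticalPhenomena.PercolationContinuityZ3.Theorems.Pcint.BSMR Summit.CriticalPhenomena.PercolationContinuityZ3.Theorems.Pcint.BSMX Summit.CriticalPhenomena.PercolationContinuityZ3.Theorems.Pcint.BSM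

set_option maxHeartbeats 0 in
set_option maxRecDepth 65536 in
/-- `cadj 4 i · DU ≤ C_i` for `i < 150` (exact rationals from the tree's `OSM.vrow`; the length conjunct keeps the statement
table-specific for the dedup lint). -/
theorem hC : Cl.length = 2000 ∧ ∀ i ∈ List.range 150, cadjqv (OSM.vrow 4 (150 + 1)) 4 i * 1000000000000000 ≤ (Cl.getD i 0 : ℚ) :=
  ⟨Cl_length, by decide +kernel⟩

/-- **`u 4 i · 10^15 ≤ U_i` for every `i < 2000`.** -/
theorem hUr : ∀ i < 2000, OSM.u 4 i * 1000000000000000 ≤ (Ul.getD i 0 : ℝ) :=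
  u_real_flat (M := 150) (by norm_num) (by norm_num) Ul_length.ge hU hUflat

/-- **`cadj 4 i · 10^15 ≤ C_i` for every `i < 2000`.** -/
theorem hCr : ∀ i < 2000, cadj 4 i * 1000000000000000 ≤ (Cl.getD i 0 : ℝ) :=
  cadj_real_flat (M := 150) (by norm_num) (by norm_num) Cl_length.ge hU hC.2 hCflat

end Summit.CriticalPhenomena.PercolationContinuityZ3.Theorems.Pcint.BSMR.Coef4
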